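import Summits.Ventures.HSemireg.WedgeHankelBoxKernel

/-!
# Venture HSemireg — GENERIC IN DEGREE 2 IS GENERIC IN DEGREE 1: `rank H_2(q) = 3 ⇒ rank H_1(q) = 2`, read off the wedge model, and
# `ker(θ ↦ θ ∧ F_q ∣ ⋀²) = SiegelBox` for EVERY box with `rank H_2(q_i) = 3` (no degree-1 hypothesis)

HONEST FRAMING. Part of the Lean index of the computation cell `pub-hsemireg` (seat p10 gen 13, Sunday typer «UNIFORM-IN-n»).
Finite-dimensional EXTERIOR ALGEBRA over a field and ranks of HANKEL MATRICES ONLY: no variety, no cohomology theory, no sheaf, no Ext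
group and no semiregularity map is constructed here; nothing here says that HC / HC_CM / HC_AV holds; no Literature fact is declared or
used.  Custodian versions cited: theory/FORMULA-N.md PART A §2.6 THEOREM H (Kronecker dictionary ρ = 1 / 2 / 3), FN-4 (i); PART B §N;
STRUCTURE.md v1.0-SIGNED 9b196a05977dd067 §1.1 C15.  The dictionary is QUOTED, never asserted.

WHAT IS KEYED.  `WedgeHankelBoxKernel` (C3, 728): `ker(θ ↦ θ ∧ F_q ∣ ⋀²) = SiegelBox` for every box whose factors have `rank H_2(q_i) = 3`
AND `rank H_1(q_i) = 2` (`ker_wedge_hankelBox_two_eq_siegelBox`); one factor: no `1`-form kills `w_m(q)` iff `rank H_1(q) = 2`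
(`Kr_w_one_eq_bot_iff`), and `Kr(univ, w_m(q), 2) = Siegel_m` when `rank H_2(q) = 3` (`Kr_w_two_eq_siegel`).  THIS FILE removes the
degree-1 hypothesis — a statement about Hankel matrices proved through the exterior algebra:
* §1 **`Kr_one_eq_bot_of_Kr_two_le`**: on th-7's model `Fin (m+m)` with `m ≥ 2`, if the degree-2 kernel space of a class `f` lies in the span
  of the MIXED monomials `x_a ∧ y_b` (bidegree `(1,1)`), then no `1`-form kills `f` — for a killing `1`-form `u`, every `x_c ∧ u` and `y_c ∧ u`
  would be a degree-2 kernel form, and their `(2,0)` / `(0,2)` coordinates are the coordinates of `u` (coordinate bookkeeping with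
  `WedgeWeilSpan`'s support spans).
* §2 the Siegel space is mixed (`siegel_le_Sp_mixed`); **`rank_hankel1_one_of_two`: `rank H_2(q) = 3 ⇒ rank H_1(q) = 2`** for every field,
  `m`, `q` (the hypothesis forces `m ≥ 4` by the width of `H_2`): a rank-`3` catalecticant in degree `2` has a rank-`2` catalecticant in
  degree `1` — obtained from `Kr² = Siegel ⊆ mixed ⇒ Kr¹ = 0 ⇒ rank H_1 = 2`, no determinant evaluated.
* §3 **`ker_wedge_hankelBox_two_eq_siegelBox'`: for every box with `rank H_2(q_i) = 3` for all `i` (every field, `n ≥ 1`, dimensions):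
  `ker(θ ↦ θ ∧ F_q ∣ ⋀²) = SiegelBox`** — 629's «numerically forced, NOT typed» statement with exactly its natural hypothesis.
NOT typed here: `rank H_k = k+1 ⇒ rank H_j = j+1` for `j < k` in general; anything Ext-side.  Class side only.
Namespace `Summit.Ventures.HSemireg.Wedge.HankelBoxKernel` (continued); new names only.
-/

open Module

namespace Summit.Ventures.HSemireg.Wedge.HankelBoxKernel

open Summit.Ventures.HSemireg.Wedge Summit.Ventures.HSemireg.Wedge.Kunneth Summit.Ventures.HSemireg.Wedge.MixedBox
  Summit.Ventures.HSemireg.Wedge.KunnethKernel Summit.Ventures.HSemireg.Wedge.HankelBox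

variable (K : Type*) [Field K]

/-! ## §1. A class whose degree-2 kernel is mixed is killed by no `1`-form -/

section One

variable (m : ℕ)

/-- the MIXED predicate on supports: the monomial meets the `x`-block and the `y`-block. -/
def Mixed (s : Finset (Hankel.In m)) : Prop := (∃ i ∈ s, (i : ℕ) < m) ∧ ∃ i ∈ s, m ≤ (i : ℕ)

/-- a degree-`1` element is the combination of the generators with its singleton coordinates. -/
lemma eq_sum_coord_gx {u : HT K (Hankel.In m)} (hu : u ∈ Hom K (Hankel.In m) Finset.univ 1) :
    u = ∑ i : Hankel.In m, (B K (Hankel.In m)).coord {i} u • gx K i := by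
  classical
  have h := ((B K (Hankel.In m)).sum_repr u).symm
  conv_lhs => rw [h]
  rw [← Finset.sum_subset (Finset.subset_univ (Finset.univ.image fun i : Hankel.In m => ({i} : Finset (Hankel.In m))))]
  · rw [Finset.sum_image (fun i _ j _ h => Finset.singleton_injective h)]
    rfl
  · intro s _ hs
    have hne : ¬ (s ⊆ Finset.univ ∧ s.card = 1) := by
      rintro ⟨-, hc⟩
      obtain ⟨i, rfl⟩ := Finset.card_eq_one.mp hc
      exact hs (Finset.mem_image.mpr ⟨i, Finset.mem_univ _, rfl⟩)
    rw [show ((B K (Hankel.In m)).repr u) s = (B K (Hankel.In m)).coord s u from rfl, coord_eq_zero_of_mem_Hom K hu hne, zero_smul]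

/-- the `{c, i}`-coordinate of `e_c ∧ u` is the structure constant `u({c},{i})` times the `{i}`-coordinate of the `1`-form `u`. -/
lemma coord_gx_mul {u : HT K (Hankel.In m)} (hu : u ∈ Hom K (Hankel.In m) Finset.univ 1) (c i : Hankel.In m) :
    (B K (Hankel.In m)).coord ({c} ∪ {i}) (gx K c * u) = Wedge.u K {c} {i} * (B K (Hankel.In m)).coord {i} u := by
  classical
  conv_lhs => rw [eq_sum_coord_gx K m hu, Finset.mul_sum]
  simp_rw [mul_smul_comm, gx, B_mul_B, map_sum, map_smul, coord_B_B]
  rw [Finset.sum_eq_single i]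
  · rw [if_pos rfl, smul_eq_mul, smul_eq_mul, mul_one, mul_comm]
  · intro j _ hji
    by_cases hcj : c = j
    · subst hcj
      rw [u_eq_zero K (by simp), zero_smul, smul_zero]
    · rw [if_neg, smul_zero, smul_zero]
      intro h
      have hj : j ∈ ({c} ∪ {i} : Finset (Hankel.In m)) := by rw [← h]; simp
      simp only [Finset.mem_union, Finset.mem_singleton] at hj
      rcases hj with h1 | h1
      · exact hcj h1.symm
      · exact hji h1
  · intro h; exact absurd (Finset.mem_univ i) h

/-- **a class whose degree-2 kernel space is MIXED is killed by no `1`-form** (`m ≥ 2`): if `Kr(univ, f, 2) ≤ Sp(Mixed)` then `Kr(univ, f, 1) = 0`. -/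
theorem Kr_one_eq_bot_of_Kr_two_le (hm : 2 ≤ m) {f : HT K (Hankel.In m)}
    (h2 : Kr K Finset.univ f 2 ≤ Weil.Sp K (Mixed m)) : Kr K Finset.univ f 1 = ⊥ := by
  classical
  rw [eq_bot_iff]
  intro u hu
  obtain ⟨huH, huf⟩ := mem_Kr.mp hu
  -- every generator times `u` is a degree-2 kernel form, hence mixed
  have hgen : ∀ c : Hankel.In m, gx K c * u ∈ Weil.Sp K (Mixed m) := fun c =>
    h2 (mem_Kr.mpr ⟨by simpa using B_mul_mem_Hom K (Finset.subset_univ {c}) huH, by rw [mul_assoc, huf, mul_zero]⟩)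
  -- so every singleton coordinate of `u` vanishes
  have hcoord : ∀ i : Hankel.In m, (B K (Hankel.In m)).coord {i} u = 0 := by
    intro i
    by_cases hi : (i : ℕ) < m
    · -- an `x`-generator: pair it with another `x`-generator `c`
      obtain ⟨c, hc, hci⟩ : ∃ c : Hankel.In m, (c : ℕ) < m ∧ c ≠ i := by
        by_cases h0 : (i : ℕ) = 0
        · exact ⟨⟨1, by omega⟩, by simp; omega, fun h => by simp [Fin.ext_iff] at h; omega⟩
        · exact ⟨⟨0, by omega⟩, by simp; omega, fun h => by simp [Fin.ext_iff] at h; omega⟩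
      have hnot : ¬ Mixed m ({c} ∪ {i}) := fun ⟨_, j, hj, hjm⟩ => by
        simp only [Finset.mem_union, Finset.mem_singleton] at hj
        rcases hj with rfl | rfl <;> omega
      have h0 := Weil.coord_eq_zero_of_mem_Sp (hgen c) hnot
      rw [coord_gx_mul K m huH c i, mul_eq_zero] at h0
      exact h0.resolve_left ((u_ne_zero_iff K).mpr (Finset.disjoint_singleton.mpr hci))
    · -- a `y`-generator: pair it with another `y`-generator
      obtain ⟨c, hc, hci⟩ : ∃ c : Hankel.In m, m ≤ (c : ℕ) ∧ c ≠ i := by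
        by_cases h0 : (i : ℕ) = m
        · exact ⟨⟨m + 1, by omega⟩, by simp, fun h => by simp [Fin.ext_iff] at h; omega⟩
        · exact ⟨⟨m, by omega⟩, by simp, fun h => by simp [Fin.ext_iff] at h; omega⟩
      have hnot : ¬ Mixed m ({c} ∪ {i}) := fun ⟨⟨j, hj, hjm⟩, _⟩ => by
        simp only [Finset.mem_union, Finset.mem_singleton] at hj
        rcases hj with rfl | rfl <;> omega
      have h0 := Weil.coord_eq_zero_of_mem_Sp (hgen c) hnot
      rw [coord_gx_mul K m huH c i, mul_eq_zero] at h0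
      exact h0.resolve_left ((u_ne_zero_iff K).mpr (Finset.disjoint_singleton.mpr hci))
  rw [Submodule.mem_bot, eq_sum_coord_gx K m huH]
  exact Finset.sum_eq_zero fun i _ => by rw [hcoord i, zero_smul]

/-! ## §2. The Siegel space is mixed; `rank H_2 = 3 ⇒ rank H_1 = 2` -/

/-- the mixed products `x_a ∧ y_b` are mixed. -/
lemma X_mul_Y_mem_Sp_mixed (a b : ℕ) : Hankel.X K m a * Hankel.Y K m b ∈ Weil.Sp K (Mixed m) := by
  by_cases ha : a < m
  · by_cases hb : b < m
    · rw [Hankel.X, Hankel.Y, dif_pos ha, dif_pos hb, gx, gx, B_mul_B]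
      refine Submodule.smul_mem _ _ (Weil.B_mem_Sp ⟨⟨Hankel.xI a ha, by simp, by simp [Hankel.xI, ha]⟩,
        ⟨Hankel.yI b hb, by simp, by simp [Hankel.yI]⟩⟩)
    · rw [Hankel.Y, dif_neg hb, mul_zero]; exact Submodule.zero_mem _
  · rw [Hankel.X, dif_neg ha, zero_mul]; exact Submodule.zero_mem _

/-- **the Siegel space is mixed**: `Siegel_m ≤ Sp(Mixed)`. -/
theorem siegel_le_Sp_mixed : HankelSiegel.siegel K m ≤ Weil.Sp K (Mixed m) := by
  rw [HankelSiegel.siegel, Submodule.span_le]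
  rintro _ ⟨p, rfl⟩
  rw [SetLike.mem_coe, HankelSiegel.sgen, HankelSiegel.sv]
  refine Submodule.add_mem _ (X_mul_Y_mem_Sp_mixed K m _ _) ?_
  split_ifs
  · exact Submodule.zero_mem _
  · exact X_mul_Y_mem_Sp_mixed K m _ _

/-- `rank H_2(q) = 3` forces `m ≥ 4` (the matrix has `m − 1` columns). -/
lemma four_le_of_rank_two {q : ℕ → K} (h2 : (Hankel.hankel1 K m 2 q).rank = 3) : 4 ≤ m := by
  have h := Matrix.rank_le_width (Hankel.hankel1 K m 2 q)
  rw [h2] at h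
  omega

/-- **GENERIC IN DEGREE 2 IS GENERIC IN DEGREE 1: `rank H_2(q) = 3 ⇒ rank H_1(q) = 2`** (every field, `m`, `q`) — through the wedge model:
`Kr² = Siegel` is mixed, so no `1`-form kills the class, so `rank H_1 = 2`. -/
theorem rank_hankel1_one_of_two {q : ℕ → K} (h2 : (Hankel.hankel1 K m 2 q).rank = 3) : (Hankel.hankel1 K m 1 q).rank = 2 := by
  have hm := four_le_of_rank_two K m h2
  refine (Kr_w_one_eq_bot_iff K (by omega) q).mp (Kr_one_eq_bot_of_Kr_two_le K m (by omega) ?_)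
  rw [Kr_w_two_eq_siegel K h2]
  exact siegel_le_Sp_mixed K m

end One

/-! ## §3. The degree-2 kernel of every generic box is `SiegelBox` -/

section Box

variable {n : ℕ} (m : Fin n → ℕ)

/-- **`ker(θ ↦ θ ∧ F_q ∣ ⋀²) = SiegelBox` for EVERY box with `rank H_2(q_i) = 3` for all `i`** (every field, `n ≥ 1`, dimensions; the
degree-1 ranks follow) — 629's «numerically forced, NOT typed» equality with exactly its natural hypothesis. -/
theorem ker_wedge_hankelBox_two_eq_siegelBox' (hn : 1 ≤ n) {q : Fin n → ℕ → K} (h2 : ∀ i, (Hankel.hankel1 K (m i) 2 (q i)).rank = 3) :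
    LinearMap.ker (wedge K (Gen m) 2 (hankelBox K m q)) = (siegelBox K m).comap (⋀[K]^2 (Gen m → K)).subtype :=
  ker_wedge_hankelBox_two_eq_siegelBox K m hn (fun i => by have := four_le_of_rank_two K (m i) (h2 i); omega)
    (fun i => rank_hankel1_one_of_two K (m i) (h2 i)) h2

/-- kernel-space form: `Kr(univ, F_q, 2) = SiegelBox` for every box with `rank H_2(q_i) = 3`. -/
theorem Kr_hankelBox_two_eq_siegelBox' (hn : 1 ≤ n) {q : Fin n → ℕ → K} (h2 : ∀ i, (Hankel.hankel1 K (m i) 2 (q i)).rank = 3) :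
    Kr K Finset.univ (hankelBox K m q) 2 = siegelBox K m :=
  Kr_hankelBox_two_eq_siegelBox K m hn (fun i => by have := four_le_of_rank_two K (m i) (h2 i); omega)
    (fun i => rank_hankel1_one_of_two K (m i) (h2 i)) h2

/-- and its dimension: **`2 · dim ker(θ ↦ θ ∧ F_q ∣ ⋀²) = Σ_i m_i (m_i + 1)`** for every such box (629's `two_mul_finrank_siegelBox`). -/
theorem two_mul_finrank_ker_wedge_hankelBox_two (hn : 1 ≤ n) {q : Fin n → ℕ → K}
    (h2 : ∀ i, (Hankel.hankel1 K (m i) 2 (q i)).rank = 3) :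
    2 * finrank K (LinearMap.ker (wedge K (Gen m) 2 (hankelBox K m q))) = ∑ i : Fin n, m i * (m i + 1) := by
  rw [ker_wedge_hankelBox_two_eq_siegelBox' K m hn h2, (Submodule.comapSubtypeEquivOfLe (siegelBox_le_exteriorPower K m)).finrank_eq]
  exact two_mul_finrank_siegelBox K m

end Box

end Summit.Ventures.HSemireg.Wedge.HankelBoxKernel
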